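import Summits.ValiantsHypothesis.ValiantsHypothesis.Theorems.GrenetZeonDualUnipotentThreeHalvesHeavyTopThmCUniformCorollaries
import Summits.ValiantsHypothesis.ValiantsHypothesis.Theorems.GrenetZeonDualUnipotentThreeHalvesHeavyTopCompositionBoundFiveSeven

/-!
# `GrenetZeon.DualUnipotentThreeHalves` (stmt-ValiantsHypothesis-24318), R2 heavy-top instrument — COROLLARY II port, step (c1):
# the DEFICIENCY TABLE of an irreducible diagonal block (sizes `1`, `2`, `3`, `≥ 4`)

The classification of the codimension-one nilpotent spaces (crux note `CENSUS-THMC-UNIFORM-eng1g5.md` §8, composition-chain route via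
✓ `HeavyTopCompositionBlocks.exists_block_conj`) reads the block sizes of a composition chain with IRREDUCIBLE diagonal blocks off this table:
an irreducible nilpotent `W ≤ M_s(ℂ)` has

* `s = 1`: `W = ⊥` (`eq_bot_of_nilpotent_one`; deficiency `C(1,2) − 0 = 0`);
* `s = 2`: IMPOSSIBLE (`not_irreducible_of_nilpotent_two`: `dim W ≤ C(2,2) − 1 = 0`, and `⊥` is reducible on `ℂ²` — `not_irreducible_bot`);
* `s = 3`: `dim W ≤ 2 = C(3,2) − 1` (`finrank_le_two_of_irreducible_three`; deficiency `≥ 1`);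
* `s ≥ 4`: `dim W ≤ C(s,2) − 2` (✓ `HeavyTopThmCUniform.iota_le_choose_two_sub_two`, restated as `two_le_choose_two_sub_finrank`; deficiency `≥ 2`).

So total deficiency `1` forces exactly one block of size `3` (carrying an irreducible nilpotent PLANE) and all other blocks of size `1` — the tower
`T(p, I, q)` — or no `3`-block at all (all blocks of size `1`: triangularisable).

Honest framing: small linear algebra; nothing here proves or refutes `HeavyTopLaw`, 24318, S3b or 8062; `VP ≠ VNP` is NOT proved.  No definitions.
[val-idea-30 MEMO codim-one §0 COROLLARY II (completeness count, critic val-idea-crit-7 g7 (iii)); cell val-heavytop-census, eng-1 g5]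
-/

noncomputable section

-- single-conjunct layout: Sub = Summit, duplicated namespace component intended
set_option linter.dupNamespace false

namespace Summit.ValiantsHypothesis.ValiantsHypothesis.Theorems.GrenetZeon.HeavyTopCodimOneBlocks

open Matrix
open Summit.ValiantsHypothesis.ValiantsHypothesis.Theorems.GrenetZeon.HeavyTopCompositionBound (finrank_le_choose_two_sub_one_of_irreducible)
open Summit.ValiantsHypothesis.ValiantsHypothesis.Theorems.GrenetZeon.HeavyTopThmCUniform (iota_le_choose_two_sub_two)

/-- The zero space is REDUCIBLE on `ℂ^s` for `s ≥ 2`: the first coordinate line is invariant, non-zero and proper. -/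
theorem not_irreducible_bot {s : ℕ} (hs : 2 ≤ s) :
    ¬ ∀ U : Submodule ℂ (Fin s → ℂ), (∀ A ∈ (⊥ : Submodule ℂ (Matrix (Fin s) (Fin s) ℂ)), ∀ x ∈ U, A *ᵥ x ∈ U) → U = ⊥ ∨ U = ⊤ := by
  intro hirr
  have h0 : 0 < s := by omega
  have h1 : 1 < s := by omega
  rcases hirr (Submodule.span ℂ {Pi.single ⟨0, h0⟩ 1}) (fun A hA x _ => by
      rw [(Submodule.mem_bot ℂ).1 hA, Matrix.zero_mulVec]; exact Submodule.zero_mem _) with hbot | htop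
  · have hmem : (Pi.single ⟨0, h0⟩ 1 : Fin s → ℂ) ∈ Submodule.span ℂ {Pi.single ⟨0, h0⟩ 1} := Submodule.subset_span rfl
    rw [hbot, Submodule.mem_bot] at hmem
    have := congrFun hmem ⟨0, h0⟩
    simp at this
  · have hmem : (Pi.single ⟨1, h1⟩ 1 : Fin s → ℂ) ∈ Submodule.span ℂ {Pi.single ⟨0, h0⟩ 1} := by rw [htop]; exact Submodule.mem_top
    rw [Submodule.mem_span_singleton] at hmem
    obtain ⟨c, hc⟩ := hmem
    have := congrFun hc ⟨1, h1⟩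
    simp [Fin.ext_iff] at this

/-- **Size 1:** a nilpotent space of `1 × 1` matrices is `⊥`. -/
theorem eq_bot_of_nilpotent_one (W : Submodule ℂ (Matrix (Fin 1) (Fin 1) ℂ)) (hW : ∀ A ∈ W, IsNilpotent A) : W = ⊥ := by
  have h := Literature.LinearAlgebra.Matrix.GerstenhaberNilpotentSubspace.finrank_le_choose_two 1 W hW
  rw [Nat.choose] at h
  exact Submodule.finrank_eq_zero.1 (Nat.le_zero.1 h)

/-- **Size 2 is impossible:** no nilpotent space of `2 × 2` matrices acts irreducibly on `ℂ²`. -/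
theorem not_irreducible_of_nilpotent_two (W : Submodule ℂ (Matrix (Fin 2) (Fin 2) ℂ)) (hW : ∀ A ∈ W, IsNilpotent A) :
    ¬ ∀ U : Submodule ℂ (Fin 2 → ℂ), (∀ A ∈ W, ∀ x ∈ U, A *ᵥ x ∈ U) → U = ⊥ ∨ U = ⊤ := by
  intro hirr
  have h := finrank_le_choose_two_sub_one_of_irreducible (le_refl 2) W hW hirr
  rw [show (2 : ℕ).choose 2 - 1 = 0 from rfl] at h
  have hbot : W = ⊥ := Submodule.finrank_eq_zero.1 (Nat.le_zero.1 h)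
  subst hbot
  exact not_irreducible_bot (le_refl 2) hirr

/-- **Size 3:** an irreducible nilpotent space of `3 × 3` matrices has dimension `≤ 2 = C(3,2) − 1` (deficiency `≥ 1`). -/
theorem finrank_le_two_of_irreducible_three (W : Submodule ℂ (Matrix (Fin 3) (Fin 3) ℂ)) (hW : ∀ A ∈ W, IsNilpotent A)
    (hirr : ∀ U : Submodule ℂ (Fin 3 → ℂ), (∀ A ∈ W, ∀ x ∈ U, A *ᵥ x ∈ U) → U = ⊥ ∨ U = ⊤) :
    Module.finrank ℂ W ≤ 2 := by
  have h := finrank_le_choose_two_sub_one_of_irreducible (by norm_num) W hW hirr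
  rwa [show (3 : ℕ).choose 2 - 1 = 2 from rfl] at h

/-- **Size `≥ 4`:** an irreducible nilpotent space of `s × s` matrices, `s ≥ 4`, has deficiency `≥ 2`: `dim W + 2 ≤ C(s,2)`
(✓ COROLLARY I `iota_le_choose_two_sub_two`, without `ℕ`-subtraction). -/
theorem finrank_add_two_le_choose_two {s : ℕ} (hs : 4 ≤ s) (W : Submodule ℂ (Matrix (Fin s) (Fin s) ℂ)) (hW : ∀ A ∈ W, IsNilpotent A)
    (hirr : ∀ U : Submodule ℂ (Fin s → ℂ), (∀ A ∈ W, ∀ x ∈ U, A *ᵥ x ∈ U) → U = ⊥ ∨ U = ⊤) :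
    Module.finrank ℂ W + 2 ≤ s.choose 2 := by
  have h := iota_le_choose_two_sub_two hs W hW hirr
  have h6 : 6 ≤ s.choose 2 := by
    have := Nat.choose_le_choose 2 hs
    rwa [show (4 : ℕ).choose 2 = 6 from rfl] at this
  omega

/-- **The deficiency table in one statement:** for an irreducible nilpotent `W ≤ M_s(ℂ)`, `s ≠ 2`, and `dim W + 1 ≤ C(s,2)` unless `s ≤ 1`
(where `C(s,2) = 0 = dim W`), with `dim W + 2 ≤ C(s,2)` as soon as `s ≥ 4`. -/
theorem block_deficiency {s : ℕ} (W : Submodule ℂ (Matrix (Fin s) (Fin s) ℂ)) (hW : ∀ A ∈ W, IsNilpotent A)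
    (hirr : ∀ U : Submodule ℂ (Fin s → ℂ), (∀ A ∈ W, ∀ x ∈ U, A *ᵥ x ∈ U) → U = ⊥ ∨ U = ⊤) :
    s ≠ 2 ∧ (2 ≤ s → Module.finrank ℂ W + 1 ≤ s.choose 2) ∧ (4 ≤ s → Module.finrank ℂ W + 2 ≤ s.choose 2) := by
  refine ⟨?_, fun h2 => ?_, fun h4 => finrank_add_two_le_choose_two h4 W hW hirr⟩
  · rintro rfl
    exact not_irreducible_of_nilpotent_two W hW hirr
  · have h := finrank_le_choose_two_sub_one_of_irreducible h2 W hW hirr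
    have h1 : 1 ≤ s.choose 2 := by
      have := Nat.choose_le_choose 2 h2
      rwa [show (2 : ℕ).choose 2 = 1 from rfl] at this
    omega

end Summit.ValiantsHypothesis.ValiantsHypothesis.Theorems.GrenetZeon.HeavyTopCodimOneBlocks

end
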